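import Summits.PneNP.PneNP.Theorems.SzkEntropyPeaWorstToAvgDualModeCompileAdviceElimMachineB
import Summits.PneNP.PneNP.Theorems.SzkEntropyPeaWorstToAvgDualModeCompileAdviceElimRate
import Summits.PneNP.PneNP.Theorems.SzkEntropyPeaWorstToAvgDualModeCompileDefs

/-!
# Route SzkEntropy, crux `PeaWorstToAvg` (stmt-PneNP-10777), line `dual-mode-compile`:
# STUB 3 `stub_adviceElim` — advice elimination by labelled self-testing

The registered stub `stub_adviceElim` of the skeleton
`Summits/PneNP/PneNP/Cruxes/PeaWorstToAvg/Lines/dual-mode-compile.lean`: a randomized heuristic scheme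
(`HeurBPP`; in the tree's `RandAlg` model its coin budget `coinLen` is an arbitrary polynomially bounded function
of the input length — `O(log)` bits of advice) for the fair mixture `½ K₀ + ½ K₁` of the laws of two UNIFORM
samplers `S_false`, `S_true` (honest polynomial budget `c`) supported on the NO resp. YES instances of a disjoint
promise problem `Q` yields a UNIFORM scheme (`UHeurBPP`, honest polynomial coin budget) for `(Q.yes, mixture)`.

The uniform scheme is `AdviceElim.uScheme` (`…AdviceElimMachineB.lean`): pad every query to the common length
`G`, so that the simulated scheme `A` uses ONE unknown budget `c⋆ = coinLen_A G ≤ P`; for every candidate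
budget `c ≤ P` estimate the error of the `k`-fold majority vote of `A` read with `c` coins on `N` fresh
LABELLED samples `(b, S_b(1ⁿ))` (label = `b`, by the promise certificates and disjointness); answer with the
first candidate whose empirical error is `≤ τ`.  The analysis (`…AdviceElimCount/Rate.lean`): the true budget
passes and no candidate of rate `≥ 4θ` passes except with probability `≤ 1/16` (Hoeffding, union bound); the
selected candidate's average error is `< 4θ`, so by Markov the inputs of error `≥ 1/4` have mass `≤ 64θ/3`;
with `θ = 1/(64ℓ)`, `ℓ = 2n + m + 4 ≥ m`, this is `≤ 1/m`.  Here the parameters are instantiated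
(`k = 2048ℓ`, `N = 131072 ℓ² (P+2)`, `τ = 6144 ℓ (P+2)`, `M = 64ℓ(T+1)`, `G = 2T + 2ℓ + 4 + M`, `T` a
polynomial bound on the samplers' output length) and the numerics discharged.

References: A. Bogdanov, L. Trevisan, *Average-Case Complexity* (2006), Def. 2.12–2.13, Lemma 3.2;
S. Arora, B. Barak (2009), §6.3, §7.4.1, Thm. 7.10; R. Impagliazzo, A. Wigderson, JCSS 63 (2001), Lemma 14;
J. Feigenbaum, L. Fortnow, SICOMP 22 (1993) (random self-reducibility and advice).
-/

noncomputable section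

open _root_.Computability
open Literature.Computability.Complexity Literature.Computability.MetaComplexity
open Polynomial
open scoped ENNReal

namespace Summit.PneNP.PneNP.Cruxes.PeaWorstToAvg.DualModeCompile

set_option linter.dupNamespace false -- `Summit.PneNP.PneNP.…`: summit = sub-problem name (D-0017 single-conjunct layout)

/-! ### The samplers: output length and labels -/

/-- **Uniform samplers have polynomially bounded outputs**: some polynomial `T` bounds `|y|` for every `y` in
the support of `S_b(1ⁿ)` (the run map is an `FP` string function, `runStr_mem_FP`, whose outputs are
polynomially bounded, `exists_poly_length_le_of_mem_FP`; the budget is the polynomial `c`).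
[BogdanovTrevisan2006, §2.1 (remark after Def. 2.1)] -/
theorem adviceElim_exists_lengthPoly (S : Bool → RandAlg ℕ (List Bool))
    (hS : ∀ b, (S b).IsPolyTime unaryEncodeNat (id : List Bool → List Bool))
    (c : Polynomial ℕ) (hc : ∀ b ℓ, (S b).coinLen ℓ = c.eval ℓ) :
    ∃ T : Polynomial ℕ, ∀ b n, ∀ y ∈ ((S b).outputPMF unaryEncodeNat n).support, y.length ≤ T.eval n := by
  obtain ⟨s₀, hs₀⟩ := exists_poly_length_le_of_mem_FP (runStr_mem_FP (hS false))
  obtain ⟨s₁, hs₁⟩ := exists_poly_length_le_of_mem_FP (runStr_mem_FP (hS true))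
  refine ⟨(s₀ + s₁).comp (2 * X + 2 + c), fun b n y hy => ?_⟩
  rw [RandAlg.outputPMF, PMF.mem_support_map_iff] at hy
  obtain ⟨v, -, rfl⟩ := hy
  have hn : (unaryEncodeNat n).length = n := by
    rw [OracleCompose.unaryEncodeNat_eq_replicate, List.length_replicate]
  have hlen : (boolPair (unaryEncodeNat n) v.toList).length = 2 * n + 2 + c.eval n := by
    rw [length_boolPair, v.toList_length, hc, hn]
  have hrun : ∀ b', runStr (S b') (boolPair (unaryEncodeNat n) v.toList) = (S b').run n v.toList := fun b' => by
    simp only [runStr, Brick.fstF_boolPair, Brick.sndF_boolPair, hn]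
  have heval : ((s₀ + s₁).comp (2 * X + 2 + c)).eval n = s₀.eval (2 * n + 2 + c.eval n) + s₁.eval (2 * n + 2 + c.eval n) := by
    simp [eval_comp]
  rw [← hrun, heval]
  cases b
  · exact (hs₀ _).trans (by rw [hlen]; exact Nat.le_add_right _ _)
  · exact (hs₁ _).trans (by rw [hlen]; exact Nat.le_add_left _ _)

/-- **Samples come labelled**: on the support of `S_b(1ⁿ)` the indicator of `Q.yes` is `b` (certificates
`h₀`, `h₁` and disjointness of the promise). [BogdanovTrevisan2006, Def. 2.12] -/
theorem adviceElim_label {Q : PromiseProblem} (hQ : Q.Disjoint) {S : Bool → RandAlg ℕ (List Bool)}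
    (h₀ : ∀ n, ∀ w ∈ ((S false).outputPMF unaryEncodeNat n).support, w ∈ Q.no)
    (h₁ : ∀ n, ∀ w ∈ ((S true).outputPMF unaryEncodeNat n).support, w ∈ Q.yes) (n : ℕ) :
    ∀ b, ∀ y ∈ ((S b).outputPMF unaryEncodeNat n).support, Q.yes.boolIndicator y = b := by
  rintro (_ | _) y hy
  · have hnot : y ∉ Q.yes := fun h => Set.disjoint_left.1 hQ h (h₀ n y hy)
    exact Bool.eq_false_iff.2 (mt (Set.mem_iff_boolIndicator _ _).2 hnot)
  · exact (Set.mem_iff_boolIndicator _ _).1 (h₁ n y hy)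

/-! ### Numerics -/

/-- `exp(−64ℓ) ≤ 1/(64ℓ)` and the threshold arithmetic of the parameters `θ = 1/(64ℓ)`, `k = 2048ℓ`,
`N = 131072 ℓ² (P + 2)`, `τ = 6144 ℓ (P + 2)`. [folklore] -/
theorem adviceElim_numerics (ℓ P : ℕ) (hℓ : 1 ≤ ℓ) :
    Real.exp (-((2048 * ℓ : ℕ) / 32 : ℝ)) ≤ 1 / (64 * ℓ) ∧
    ((131072 * ℓ ^ 2 * (P + 2) : ℕ) : ℝ) * (2 / (64 * ℓ) + 1 / (64 * ℓ)) ≤ (6144 * ℓ * (P + 2) : ℕ) ∧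
    ((6144 * ℓ * (P + 2) : ℕ) : ℝ) ≤ (131072 * ℓ ^ 2 * (P + 2) : ℕ) * (4 / (64 * ℓ) - 1 / (64 * ℓ)) ∧
    ((P : ℝ) + 2) * Real.exp (-((1 / (64 * ℓ)) ^ 2 * ((131072 * ℓ ^ 2 * (P + 2) : ℕ) : ℝ) / 2)) ≤ 1 / 16 := by
  have hℓr : (1 : ℝ) ≤ ℓ := by exact_mod_cast hℓ
  have hℓ0 : (0 : ℝ) < ℓ := by linarith
  refine ⟨?_, ?_, ?_, ?_⟩
  · have h := exp_neg_le_inv (show (0 : ℝ) < 64 * ℓ by positivity)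
    refine le_trans (le_of_eq ?_) h
    congr 1
    push_cast
    ring
  · push_cast
    refine le_of_eq ?_
    field_simp
    ring
  · push_cast
    refine le_of_eq ?_
    field_simp
    ring
  · have hexp : (1 / (64 * (ℓ : ℝ))) ^ 2 * ((131072 * ℓ ^ 2 * (P + 2) : ℕ) : ℝ) / 2 = 16 * ((P : ℝ) + 2) := by
      push_cast
      field_simp
      ring
    rw [hexp]
    have hP : (0 : ℝ) < 16 * ((P : ℝ) + 2) := by positivity
    calc ((P : ℝ) + 2) * Real.exp (-(16 * ((P : ℝ) + 2))) ≤ ((P : ℝ) + 2) * (1 / (16 * ((P : ℝ) + 2))) :=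
          mul_le_mul_of_nonneg_left (exp_neg_le_inv hP) (by positivity)
      _ = 1 / 16 := by field_simp

/-! ### STUB 3 -/

/-- **STUB 3 · `stub_adviceElim`** (advice elimination by labelled self-testing).  If the two components of
a fair mixture are sampled by UNIFORM samplers (honest polynomial budget `c`) and lie inside the NO resp. YES
side of a disjoint promise problem (so samples come LABELLED), every advice-taking heuristic scheme `A` for
`(Q.yes, mixture)` yields a uniform one: `AdviceElim.uScheme` pads the failure parameter of every query to a
common length (one unknown budget `c⋆ ≤ P`), estimates each majority-amplified candidate budget's labelled
error on fresh samples `(b, S_b(1ⁿ))`, and runs the first candidate that passes; the true budget passes, every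
passing candidate has small average error (Hoeffding), and Markov bounds the bad inputs
(`AdviceElim.toOuterMeasure_bad_out_le`); the coin budget is an honest polynomial (`AdviceElim.MParams.coins`).
[BogdanovTrevisan2006, Def. 2.12–2.13 and Lemma 3.2; AroraBarak2009, §6.3, Thm. 7.10; ImpagliazzoWigderson2001, Lemma 14] -/
theorem stub_adviceElim (Q : PromiseProblem) (hQ : Q.Disjoint) (S : Bool → RandAlg ℕ (List Bool))
    (hS : ∀ b, (S b).IsPolyTime unaryEncodeNat (id : List Bool → List Bool))
    (c : Polynomial ℕ) (hc : ∀ b ℓ, (S b).coinLen ℓ = c.eval ℓ)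
    (h₀ : ∀ n, ∀ w ∈ ((S false).outputPMF unaryEncodeNat n).support, w ∈ Q.no)
    (h₁ : ∀ n, ∀ w ∈ ((S true).outputPMF unaryEncodeNat n).support, w ∈ Q.yes)
    (h : (⟨Q.yes, mixEnsemble (fun n => (S false).outputPMF unaryEncodeNat n)
        (fun n => (S true).outputPMF unaryEncodeNat n)⟩ : DistProblem) ∈ HeurBPP) :
    (⟨Q.yes, mixEnsemble (fun n => (S false).outputPMF unaryEncodeNat n)
        (fun n => (S true).outputPMF unaryEncodeNat n)⟩ : DistProblem) ∈ UHeurBPP := by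
  obtain ⟨A, hA, hbad⟩ := h
  obtain ⟨pA, hpA⟩ := hA.2
  obtain ⟨T, hT⟩ := adviceElim_exists_lengthPoly S hS c hc
  -- the machine's polynomials
  set Gp : Polynomial ℕ := 2 * T + 2 * X + 4 + 64 * X * (T + 1) with hGp
  set mp : AdviceElim.MParams :=
    ⟨c, Gp, pA, 2048 * X, 131072 * X ^ 2 * (pA.comp Gp + 2), 6144 * X * (pA.comp Gp + 2)⟩ with hmp
  refine ⟨AdviceElim.uScheme mp S A, AdviceElim.uScheme_isPolyTime mp hS hA, ⟨mp.coins, fun ℓ => rfl⟩,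
    fun n m hm => ?_⟩
  -- the parameters at `(n, m)`
  set D : Ensemble := mixEnsemble (fun n => (S false).outputPMF unaryEncodeNat n)
    (fun n => (S true).outputPMF unaryEncodeNat n) with hD
  set ℓ : ℕ := (schemeEnc (([] : List Bool), n, m)).length with hℓdef
  have hℓ : ℓ = 2 * n + m + 4 := by simp [hℓdef, length_schemeEnc]
  have hℓ1 : 1 ≤ ℓ := by omega
  set P : ℕ := pA.eval (Gp.eval ℓ) with hPdef
  have hpmG : (mp.pm n m).G = Gp.eval ℓ := rfl
  have hpmP : (mp.pm n m).P = P := by rw [AdviceElim.MParams.pm_P]; rfl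
  have hpmk : (mp.pm n m).k = 2048 * ℓ := by simp [hmp, AdviceElim.MParams.pm, AdviceElim.MParams.params, ← hℓdef]
  have hpmN : (mp.pm n m).N = 131072 * ℓ ^ 2 * (P + 2) := by
    simp [hmp, AdviceElim.MParams.pm, AdviceElim.MParams.params, ← hℓdef, hPdef, eval_comp]
  have hpmτ : (mp.pm n m).τ = 6144 * ℓ * (P + 2) := by
    simp [hmp, AdviceElim.MParams.pm, AdviceElim.MParams.params, ← hℓdef, hPdef, eval_comp]
  have hGeval : Gp.eval ℓ = 2 * T.eval ℓ + 2 * ℓ + 4 + 64 * ℓ * (T.eval ℓ + 1) := by simp [hGp]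
  -- the hypotheses of the analysis
  obtain ⟨hnum1, hnum2, hnum3, hnum4⟩ := adviceElim_numerics ℓ P hℓ1
  have hTmono : T.eval n ≤ T.eval ℓ := TM2Iter.eval_mono T (by omega)
  have hM : 0 < 64 * ℓ * (T.eval ℓ + 1) := by positivity
  have hG : 2 * T.eval n + 2 * (mp.pm n m).n + 4 + 64 * ℓ * (T.eval ℓ + 1) ≤ (mp.pm n m).G := by
    rw [hpmG, hGeval, AdviceElim.MParams.pm_n]
    omega
  have hP : A.coinLen (mp.pm n m).G ≤ (mp.pm n m).P := by rw [hpmP, hPdef, hpmG]; exact hpA _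
  have hbad' : ∀ m' : ℕ, 0 < m' → (D (mp.pm n m).n).toOuterMeasure
      {x | 1 / 4 ≤ A.pr schemeEnc (x, (mp.pm n m).n, m') {b | b ≠ Q.yes.boolIndicator x}} ≤ ((m' : ℕ) : ℝ≥0∞)⁻¹ :=
    fun m' hm' => toOuterMeasure_le_inv_of_prob_le hm' (hbad n m' hm')
  have hℓ0 : (0 : ℝ) < ℓ := by exact_mod_cast hℓ1
  have hρ : (T.eval n + 1 : ℝ) / (64 * ℓ * (T.eval ℓ + 1) : ℕ) + Real.exp (-((mp.pm n m).k / 32 : ℝ)) ≤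
      2 / (64 * ℓ) := by
    rw [hpmk]
    have hT' : ((T.eval n : ℕ) : ℝ) ≤ ((T.eval ℓ : ℕ) : ℝ) := by exact_mod_cast hTmono
    have hdiv : (T.eval n + 1 : ℝ) / (64 * ℓ * (T.eval ℓ + 1) : ℕ) ≤ 1 / (64 * ℓ) := by
      rw [div_le_div_iff₀ (by positivity) (by positivity)]
      push_cast
      nlinarith
    have h2 : (1 : ℝ) / (64 * ℓ) + 1 / (64 * ℓ) = 2 / (64 * ℓ) := by ring
    linarith
  have hcn : ∀ b, (S b).coinLen (unaryEncodeNat (mp.pm n m).n).length = (mp.pm n m).cn := fun b => by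
    rw [hc, AdviceElim.MParams.pm_n, AdviceElim.MParams.pm_cn, OracleCompose.unaryEncodeNat_eq_replicate,
      List.length_replicate]
  have hmain := AdviceElim.toOuterMeasure_bad_out_le (A := A) (S := S) (mp.pm n m) (lab := Q.yes.boolIndicator)
    (T := T.eval n) (M := 64 * ℓ * (T.eval ℓ + 1)) (θ := 1 / (64 * ℓ)) (β := 4 / (64 * ℓ)) (ρ := 2 / (64 * ℓ))
    hcn (adviceElim_label hQ h₀ h₁ n) (fun b y hy => hT b n y hy) hbad' hM hG hP (by rw [hpmk]; omega)
    (by rw [hpmN]; positivity) (by positivity) hρ (by rw [hpmN, hpmτ]; exact hnum2) (by rw [hpmN, hpmτ]; exact hnum3)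
    (by rw [hpmP, hpmN]; exact hnum4)
  -- conclusion
  show D.prob n {x | 1 / 4 ≤ (AdviceElim.uScheme mp S A).pr schemeEnc (x, n, m) {b | b ≠ Q.yes.boolIndicator x}} ≤ 1 / m
  simp only [AdviceElim.uScheme_pr_ne]
  rw [Ensemble.prob]
  have hfin : (ENNReal.ofReal (16 * (4 / (64 * (ℓ : ℝ))) / 3)).toReal = 1 / (3 * ℓ) := by
    rw [ENNReal.toReal_ofReal (by positivity)]
    field_simp
    ring
  refine ((ENNReal.toReal_mono ENNReal.ofReal_ne_top hmain).trans_eq hfin).trans ?_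
  rw [div_le_div_iff₀ (by positivity) (by exact_mod_cast hm)]
  have hmℓ : (m : ℝ) ≤ ℓ := by exact_mod_cast (show m ≤ ℓ by omega)
  linarith

end Summit.PneNP.PneNP.Cruxes.PeaWorstToAvg.DualModeCompile

end
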